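import Literature.Topology.FourManifolds.RegularLevelSplitting
import Literature.Topology.FourManifolds.BoundaryGluingData
import Literature.Topology.FourManifolds.CorkDecompositionSplittingProof
import Summits.SmoothPoincare4.SmoothPoincare4.Theorems.ConvexBisectionAcyclicBisectionExistsSplitComplementPushforward
import HarnessLib

/-!
# The complement piece, II: the pushed-in copy of `X₁` inside `M ⊇ X ⊇ X₁ ∖ ∂X₁` is a regular
# superlevel set `{G ≥ c}`
(helper file 2/3 of the wave-2 brick T2 "the complement piece `W₂`" for stub
`stub_steinRealisation` (NF6), line `modp-braid-orbits` r11, crux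
`ConvexBisection.AcyclicBisectionExists`, item stmt-SmoothPoincare4-10508; lead c4)

Setting (abstracting Baykur's `X₊ ⊂ X(F; P ++ N) ⊂ M`, proof of Thm. 5.1 of Baykur 2006): `X₁` a
compact `4`-manifold with boundary with an open collar `D` of a boundary datum `b`; an open
submanifold `C ⊆ X₁` containing the interior (in the application `C = X₁ ∖ ⋃ cores` of the lifted
negative handles, Kosinski's piece of `X = X₁ ∪ (handles)`); an open smooth embedding `jA : C → X`
into a `4`-manifold with boundary; a smooth embedding `jX : X → M` into a `4`-manifold without
boundary (a piece of the closed gluing `M = X ∪_Ψ Base g`).  The ramped collar height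
`cutHeight D` (file 1/3: zero near `∂X₁`, the collar height near the level `c = shrinkConst`) is
pushed forward by zero along the open immersions `jA` and `jX|Int X`
(`contMDiff_extend_zero_of_isImmersionAt`), giving a smooth `G = pushB : M → ℝ` with
**regular level `c`** (`isRegularLevel_pushB`) whose **superlevel set `{c ≤ G}` is
`jX (jA (range of the shrink map))`** (`le_pushB_iff`), i.e. a pushed-in copy of `X₁`
(Milnor 1963, Thm. 3.1: `M = {G ≤ c} ∪ {G ≥ c}`; Kosinski 1993, VI.5).

* `pushA`, `pushA_apply`, `contMDiff_pushA`, `pushA_eq_zero_of_mem_boundary`;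
* `intOpens`, `jInt`, `pushB`, `pushB_jX`, `contMDiff_pushB`, `isRegularLevel_pushB`, `le_pushB_iff`,
  and the registered `helper_exists_regularLevel_pushforward`.

Everything is proved; no named facts.

## References
* R. İ. Baykur, *Kähler decomposition of 4-manifolds*, AGT 6 (2006), proof of Thm. 5.1. [Baykur2006]
* J. Milnor, *Morse theory* (1963), Thm. 3.1. [Milnor1963]
* A. A. Kosinski, *Differential Manifolds* (1993), VI §1 (proof of (1.1)), VI §5, §6. [Kosinski1993]
-/

noncomputable section

-- the prescribed namespace `Summit.<P>.<Sub>.…` duplicates `SmoothPoincare4` (P = Sub)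
set_option linter.dupNamespace false

open scoped Manifold ContDiff Topology

namespace Summit.SmoothPoincare4.SmoothPoincare4.Theorems.AcyclicBisectionExists.ModpBraidOrbits

open Set Function Filter
open Literature.Topology.FourManifolds CollarShrink BoundaryData.OpenCollar

/-! ### §1 Push-forward to `X` along the open embedding `jA : C → X` -/

section PushA

variable {X₁ : Type} [TopologicalSpace X₁] [ChartedSpace (EuclideanHalfSpace 4) X₁]
  {b : BoundaryData (𝓡∂ 4) X₁ (𝓡 3)} (D : b.OpenCollar) {X : Type}
  (C : TopologicalSpace.Opens X₁) (jA : C → X)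

/-- **The ramped collar height pushed forward by zero to `X`** along `jA : C → X`.
[cite: Kosinski1993, VI §1] -/
def pushA : X → ℝ := Function.extend jA (fun a => cutHeight D a.1) 0

variable {C jA}

/-- `pushA (jA a) = cutHeight a` (`jA` injective). [folklore] -/
theorem pushA_apply (hinj : Injective jA) (a : C) : pushA D C jA (jA a) = cutHeight D a.1 :=
  extend_zero_apply hinj _ a

/-- `pushA = 0` off `jA(C)`. [folklore] -/
theorem pushA_of_not_mem {x : X} (hx : x ∉ range jA) : pushA D C jA x = 0 :=
  extend_zero_of_not_mem_range _ hx

/-- A point where `pushA ≠ 0` is `jA a` with `cutHeight a ≠ 0`. [folklore] -/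
theorem exists_of_pushA_ne_zero (hinj : Injective jA) {x : X} (hx : pushA D C jA x ≠ 0) :
    ∃ a : C, jA a = x ∧ cutHeight D a.1 ≠ 0 := by
  by_cases h : x ∈ range jA
  · obtain ⟨a, rfl⟩ := h
    exact ⟨a, rfl, by rwa [pushA_apply D hinj] at hx⟩
  · exact absurd (pushA_of_not_mem D h) hx

variable [TopologicalSpace X] [ChartedSpace (EuclideanHalfSpace 4) X]
  [IsManifold (𝓡∂ 4) ∞ X₁] [IsManifold (𝓡∂ 4) ∞ X]

omit [IsManifold (𝓡∂ 4) ∞ X] in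
/-- An open smooth embedding of an open submanifold maps interior points to interior points.
[folklore] -/
theorem isInteriorPoint_opens_embedding (hjA : Manifold.IsSmoothEmbedding (𝓡∂ 4) (𝓡∂ 4) ∞ jA)
    (hjAo : IsOpen (range jA)) {a : C} (ha : (𝓡∂ 4).IsInteriorPoint a.1) :
    (𝓡∂ 4).IsInteriorPoint (jA a) := by
  rw [ModelWithCorners.isInteriorPoint_iff_not_isBoundaryPoint] at ha ⊢
  intro hb
  have hb' : jA a ∈ (𝓡∂ 4).boundary X := hb
  rw [mem_boundary_iff_of_isSmoothEmbedding hjA hjAo, mem_boundary_opens_iff] at hb'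
  exact ha hb'

omit [IsManifold (𝓡∂ 4) ∞ X] in
/-- `pushA` vanishes on the boundary of `X` (an open embedding preserves boundary points, and the
ramped height vanishes on `∂X₁`). [folklore] -/
theorem pushA_eq_zero_of_mem_boundary (hjA : Manifold.IsSmoothEmbedding (𝓡∂ 4) (𝓡∂ 4) ∞ jA)
    (hjAo : IsOpen (range jA)) {x : X} (hx : x ∈ (𝓡∂ 4).boundary X) : pushA D C jA x = 0 := by
  by_contra h
  obtain ⟨a, rfl, ha⟩ := exists_of_pushA_ne_zero D hjA.isEmbedding.injective h
  rw [mem_boundary_iff_of_isSmoothEmbedding hjA hjAo, mem_boundary_opens_iff] at hx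
  exact ha (cutHeight_eq_zero_of_mem_boundary D hx)

omit [IsManifold (𝓡∂ 4) ∞ X] in
/-- A point where `pushA ≠ 0` is an interior point of `X`. [folklore] -/
theorem isInteriorPoint_of_pushA_ne_zero (hjA : Manifold.IsSmoothEmbedding (𝓡∂ 4) (𝓡∂ 4) ∞ jA)
    (hjAo : IsOpen (range jA)) {x : X} (hx : pushA D C jA x ≠ 0) : (𝓡∂ 4).IsInteriorPoint x :=
  ((𝓡∂ 4).isInteriorPoint_or_isBoundaryPoint x).resolve_right fun hb =>
    hx (pushA_eq_zero_of_mem_boundary D hjA hjAo hb)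

variable [T2Space X₁] [CompactSpace X₁]

omit [TopologicalSpace X] [ChartedSpace (EuclideanHalfSpace 4) X] [IsManifold (𝓡∂ 4) ∞ X] in
/-- The set `{c/4 ≤ collarHeightFn}` seen in `C` is compact (it consists of interior points,
which lie in `C`). [folklore] -/
theorem isCompact_cutSupport_opens (hC : ∀ x, (𝓡∂ 4).IsInteriorPoint x → x ∈ C) :
    IsCompact {a : C | shrinkConst / 4 ≤ D.collarHeightFn a.1} := by
  rw [Topology.IsInducing.subtypeVal.isCompact_iff]
  convert isCompact_cutSupport D using 1
  ext z
  simp only [mem_image, mem_setOf_eq]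
  constructor
  · rintro ⟨a, ha, rfl⟩
    exact ha
  · intro hz
    exact ⟨⟨z, hC z (isInteriorPoint_of_le_collarHeightFn D hz)⟩, hz, rfl⟩

variable [T2Space X]

omit [IsManifold (𝓡∂ 4) ∞ X] in
/-- **`pushA` is smooth** for an open smooth embedding `jA` (push-forward by zero along an open
immersion, the ramped height vanishing off a compact set of `C`). [cite: Kosinski1993, VI §1] -/
theorem contMDiff_pushA (hC : ∀ x, (𝓡∂ 4).IsInteriorPoint x → x ∈ C)
    (hjA : Manifold.IsSmoothEmbedding (𝓡∂ 4) (𝓡∂ 4) ∞ jA) (hjAo : IsOpen (range jA)) :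
    ContMDiff (𝓡∂ 4) 𝓘(ℝ, ℝ) ∞ (pushA D C jA) := by
  have hinj : Injective jA := hjA.isEmbedding.injective
  refine contMDiff_extend_zero_of_isImmersionAt (fun a => hjA.isImmersion.isImmersionAt a)
    (Topology.IsOpenEmbedding.isOpenMap ⟨hjA.isEmbedding, hjAo⟩) hinj
    ((contMDiff_cutHeight D).comp contMDiff_subtype_val)
    (K := jA '' {a : C | shrinkConst / 4 ≤ D.collarHeightFn a.1})
    (((isCompact_cutSupport_opens D hC).image hjA.isEmbedding.continuous).isClosed)
    (image_subset_range _ _) fun a ha => ?_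
  apply cutHeight_eq_zero_of_le
  by_contra hlt
  exact ha ⟨a, le_of_lt (not_le.1 hlt), rfl⟩

end PushA

/-! ### §2 Push-forward to `M` along `jX` restricted to the interior of `X` -/

section PushB

variable {X₁ : Type} [TopologicalSpace X₁] [ChartedSpace (EuclideanHalfSpace 4) X₁]
  {b : BoundaryData (𝓡∂ 4) X₁ (𝓡 3)} (D : b.OpenCollar)
  {X : Type} [TopologicalSpace X] [ChartedSpace (EuclideanHalfSpace 4) X] [IsManifold (𝓡∂ 4) ∞ X]
  (C : TopologicalSpace.Opens X₁) (jA : C → X) {M : Type} (jX : X → M)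

variable (X) in
/-- The interior of `X` as an open submanifold. [folklore] -/
def intOpens : TopologicalSpace.Opens X :=
  ⟨(𝓡∂ 4).interior X, ModelWithCorners.isOpen_interior (I := 𝓡∂ 4) (M := X) (n := ∞) (by simp)⟩

/-- `jX` restricted to the interior of `X`. [folklore] -/
def jInt (v : intOpens X) : M := jX v.1

/-- **The ramped collar height pushed forward by zero to `M`** along `jX ∘ jA`.
[cite: Kosinski1993, VI §1] -/
def pushB : M → ℝ := Function.extend (jInt jX) (fun v => pushA D C jA v.1) 0

variable {C jA jX}

/-- `jX|Int X` is injective if `jX` is. [folklore] -/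
theorem injective_jInt (hinj : Injective jX) : Injective (jInt jX) :=
  fun _ _ h => Subtype.ext (hinj h)

/-- `pushB = 0` off `jX(X)`. [folklore] -/
theorem pushB_of_not_mem {p : M} (hp : p ∉ range jX) : pushB D C jA jX p = 0 :=
  extend_zero_of_not_mem_range _ fun ⟨v, hv⟩ => hp ⟨v.1, hv⟩

variable [IsManifold (𝓡∂ 4) ∞ X₁]

/-- **`pushB ∘ jX = pushA`** (on the interior by construction; on `∂X` both vanish). [folklore] -/
theorem pushB_jX (hjA : Manifold.IsSmoothEmbedding (𝓡∂ 4) (𝓡∂ 4) ∞ jA) (hjAo : IsOpen (range jA))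
    (hinj : Injective jX) (x : X) : pushB D C jA jX (jX x) = pushA D C jA x := by
  rcases (𝓡∂ 4).isInteriorPoint_or_isBoundaryPoint x with hx | hx
  · exact extend_zero_apply (injective_jInt hinj) (fun v => pushA D C jA v.1) ⟨x, hx⟩
  · rw [pushA_eq_zero_of_mem_boundary D hjA hjAo hx]
    refine extend_zero_of_not_mem_range _ ?_
    rintro ⟨v, hv⟩
    have h1 : v.1 = x := hinj hv
    exact ((𝓡∂ 4).isInteriorPoint_iff_not_isBoundaryPoint x).1 (h1 ▸ v.2) hx

/-- A point where `pushB ≠ 0` is `jX (jA a)` with `cutHeight a ≠ 0`. [folklore] -/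
theorem exists_of_pushB_ne_zero (hjA : Manifold.IsSmoothEmbedding (𝓡∂ 4) (𝓡∂ 4) ∞ jA)
    (hjAo : IsOpen (range jA)) (hinj : Injective jX) {p : M} (hp : pushB D C jA jX p ≠ 0) :
    ∃ a : C, jX (jA a) = p ∧ cutHeight D a.1 ≠ 0 := by
  by_cases h : p ∈ range jX
  · obtain ⟨x, rfl⟩ := h
    rw [pushB_jX D hjA hjAo hinj] at hp
    obtain ⟨a, rfl, ha⟩ := exists_of_pushA_ne_zero D hjA.isEmbedding.injective hp
    exact ⟨a, rfl, ha⟩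
  · exact absurd (pushB_of_not_mem D h) hp

/-- **The superlevel set `{c ≤ pushB}`** is `jX (jA {c ≤ collarHeightFn})`, i.e. `jX ∘ jA` of the
range of the shrink map (`le_collarHeightFn_iff_mem_range_shrink`). [cite: Milnor1963, Thm. 3.1] -/
theorem le_pushB_iff (hjA : Manifold.IsSmoothEmbedding (𝓡∂ 4) (𝓡∂ 4) ∞ jA) (hjAo : IsOpen (range jA))
    (hinj : Injective jX) (p : M) :
    shrinkConst ≤ pushB D C jA jX p ↔
      ∃ a : C, jX (jA a) = p ∧ shrinkConst ≤ D.collarHeightFn a.1 := by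
  constructor
  · intro h
    obtain ⟨a, rfl, -⟩ := exists_of_pushB_ne_zero D hjA hjAo hinj (shrinkConst_pos.trans_le h).ne'
    rw [pushB_jX D hjA hjAo hinj, pushA_apply D hjA.isEmbedding.injective, le_cutHeight_iff] at h
    exact ⟨a, rfl, h⟩
  · rintro ⟨a, rfl, ha⟩
    rw [pushB_jX D hjA hjAo hinj, pushA_apply D hjA.isEmbedding.injective, le_cutHeight_iff]
    exact ha

/-- **The level `{pushB = c}`** is `jX (jA {cutHeight = c})`. [cite: Milnor1963, Thm. 3.1] -/
theorem pushB_eq_iff (hjA : Manifold.IsSmoothEmbedding (𝓡∂ 4) (𝓡∂ 4) ∞ jA) (hjAo : IsOpen (range jA))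
    (hinj : Injective jX) (p : M) :
    pushB D C jA jX p = shrinkConst ↔ ∃ a : C, jX (jA a) = p ∧ cutHeight D a.1 = shrinkConst := by
  constructor
  · intro h
    obtain ⟨a, rfl, -⟩ := exists_of_pushB_ne_zero D hjA hjAo hinj
      (by rw [h]; exact shrinkConst_pos.ne')
    rw [pushB_jX D hjA hjAo hinj, pushA_apply D hjA.isEmbedding.injective] at h
    exact ⟨a, rfl, h⟩
  · rintro ⟨a, rfl, ha⟩
    rw [pushB_jX D hjA hjAo hinj, pushA_apply D hjA.isEmbedding.injective]
    exact ha

variable [TopologicalSpace M] [ChartedSpace (EuclideanSpace ℝ (Fin 4)) M] [IsManifold (𝓡 4) ∞ M]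

omit [IsManifold (𝓡∂ 4) ∞ X₁] in
/-- `jX|Int X` is an open map (an equidimensional smooth embedding is open on the interior,
`isOpen_image_of_isSmoothEmbedding_of_subset_interior`). [folklore] -/
theorem isOpenMap_jInt (hjX : Manifold.IsSmoothEmbedding (𝓡∂ 4) (𝓡 4) ∞ jX) : IsOpenMap (jInt jX) := by
  intro U hU
  have h1 : jInt jX '' U = jX '' (Subtype.val '' U) := by
    rw [image_image]
    rfl
  rw [h1]
  exact isOpen_image_of_isSmoothEmbedding_of_subset_interior hjX
    ((intOpens X).isOpen.isOpenMap_subtype_val U hU) (by rintro _ ⟨v, -, rfl⟩; exact v.2)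

omit [IsManifold (𝓡∂ 4) ∞ X₁] [IsManifold (𝓡 4) ∞ M] in
/-- `jX|Int X` is an immersion at every point. [folklore] -/
theorem isImmersionAt_jInt (hjX : Manifold.IsSmoothEmbedding (𝓡∂ 4) (𝓡 4) ∞ jX) (v : intOpens X) :
    Manifold.IsImmersionAt (𝓡∂ 4) (𝓡 4) ∞ (jInt jX) v :=
  ((hjX.isImmersion.isImmersionAt v.1).isImmersionAtOfComplement_complement.comp_subtypeVal
    (intOpens X)).isImmersionAt

variable [T2Space X₁] [CompactSpace X₁] [T2Space X] [T2Space M]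

/-- **`pushB` is smooth** (push-forward by zero along the open immersion `jX|Int X`, `pushA`
vanishing off the compact `jA({c/4 ≤ collarHeightFn})`, which lies in the interior).
[cite: Kosinski1993, VI §1] -/
theorem contMDiff_pushB (hC : ∀ x, (𝓡∂ 4).IsInteriorPoint x → x ∈ C)
    (hjA : Manifold.IsSmoothEmbedding (𝓡∂ 4) (𝓡∂ 4) ∞ jA) (hjAo : IsOpen (range jA))
    (hjX : Manifold.IsSmoothEmbedding (𝓡∂ 4) (𝓡 4) ∞ jX) :
    ContMDiff (𝓡 4) 𝓘(ℝ, ℝ) ∞ (pushB D C jA jX) := by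
  have hKc : IsCompact (jX '' (jA '' {a : C | shrinkConst / 4 ≤ D.collarHeightFn a.1})) :=
    ((isCompact_cutSupport_opens D hC).image hjA.isEmbedding.continuous).image
      hjX.isEmbedding.continuous
  refine contMDiff_extend_zero_of_isImmersionAt (isImmersionAt_jInt hjX) (isOpenMap_jInt hjX)
    (injective_jInt hjX.isEmbedding.injective)
    ((contMDiff_pushA D hC hjA hjAo).comp contMDiff_subtype_val) hKc.isClosed ?_ fun v hv => ?_
  · rintro _ ⟨_, ⟨a, ha, rfl⟩, rfl⟩
    exact ⟨⟨jA a, isInteriorPoint_opens_embedding hjA hjAo (isInteriorPoint_of_le_collarHeightFn D ha)⟩,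
      rfl⟩
  · by_contra h
    obtain ⟨a, ha, ha'⟩ := exists_of_pushA_ne_zero D hjA.isEmbedding.injective h
    refine hv ⟨jA a, ⟨a, le_of_lt (lt_collarHeightFn_of_cutHeight_ne_zero D ha'), rfl⟩, ?_⟩
    show jX (jA a) = jX v.1
    rw [ha]

/-- **`c` is a regular level of `pushB`.**  A point of the level is `jX (jA a)` with
`cutHeight a = c`, a regular point of `cutHeight` (`not_isMCriticalPt_cutHeight`); near `a` (inside
the open `C`) `pushB ∘ jX ∘ jA ∘ r = cutHeight` for the local section `r : X₁ → C`, so a critical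
point of `pushB` at `jX (jA a)` would make `a` critical for `cutHeight` (chain rule,
`isMCriticalPt_of_comp_of_eventuallyEq`). [cite: Milnor1963, Thm. 3.1] -/
theorem isRegularLevel_pushB (hC : ∀ x, (𝓡∂ 4).IsInteriorPoint x → x ∈ C)
    (hjA : Manifold.IsSmoothEmbedding (𝓡∂ 4) (𝓡∂ 4) ∞ jA) (hjAo : IsOpen (range jA))
    (hjX : Manifold.IsSmoothEmbedding (𝓡∂ 4) (𝓡 4) ∞ jX) :
    IsRegularLevel (𝓡 4) (pushB D C jA jX) shrinkConst := by
  classical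
  have hinj : Injective jX := hjX.isEmbedding.injective
  have hsm := contMDiff_pushB D hC hjA hjAo hjX
  refine isRegularLevel_of_not_isMCriticalPt hsm fun p hp hcrit => ?_
  obtain ⟨a, rfl, ha⟩ := (pushB_eq_iff D hjA hjAo hinj p).1 hp
  -- the local section `r : X₁ → C` through `a`
  set r : X₁ → C := fun x => if hx : x ∈ C then ⟨x, hx⟩ else a with hr_def
  have hr : ∀ x, x ∈ C → (r x : X₁) = x := fun x hx => by simp [hr_def, hx]
  have hra : r a.1 = a := Subtype.ext (hr a.1 a.2)
  have hrs : ContMDiffAt (𝓡∂ 4) (𝓡∂ 4) ∞ r a.1 := by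
    rw [← ContMDiffAt.subtypeVal_comp_iff]
    refine contMDiffAt_id.congr_of_eventuallyEq ?_
    filter_upwards [C.isOpen.mem_nhds a.2] with x hx
    exact hr x hx
  have hJ : MDifferentiableAt (𝓡∂ 4) (𝓡 4) (fun x => jX (jA (r x))) a.1 :=
    (((hjX.contMDiff.comp hjA.contMDiff).contMDiffAt).comp a.1 hrs).mdifferentiableAt (by simp)
  have hG : MDifferentiableAt (𝓡 4) 𝓘(ℝ, ℝ) (pushB D C jA jX) (jX (jA (r a.1))) :=
    (hsm _).mdifferentiableAt (by simp)
  have heq : (pushB D C jA jX ∘ fun x => jX (jA (r x))) =ᶠ[𝓝 a.1] cutHeight D := by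
    filter_upwards [C.isOpen.mem_nhds a.2] with x hx
    show pushB D C jA jX (jX (jA (r x))) = cutHeight D x
    rw [pushB_jX D hjA hjAo hinj, pushA_apply D hjA.isEmbedding.injective, hr x hx]
  refine not_isMCriticalPt_cutHeight D ha (isMCriticalPt_of_comp_of_eventuallyEq hJ hG heq ?_)
  rwa [hra]

/-- **Registered helper `helper_exists_regularLevel_pushforward` (sub-goal of NF6
`stub_steinRealisation`, wave 2 brick T2, lead c4): a pushed-in copy of `X₁` inside
`M ⊇ X ⊇ X₁ ∖ ∂X₁` is a regular superlevel set.**  For `X₁` compact with boundary datum `b` and open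
collar `D`, an open submanifold `C ⊇ Int X₁`, an open smooth embedding `jA : C → X` and a smooth
embedding `jX : X → M` into a manifold without boundary, there is a smooth `G : M → ℝ` with regular
level `c = shrinkConst`, vanishing off `jX(X)`, such that `c ≤ G p ↔ p = jX (jA a)` with `a` in the
range of the shrink map of `D` (so `{c ≤ G} ≅ X₁`; it is `pushB`, with `pushB ∘ jX = pushA`).  Baykur (2006), proof of Thm. 5.1 (`M ⊃ X₊`); Milnor (1963),
Thm. 3.1. [cite: Milnor1963, Thm. 3.1] -/
theorem helper_exists_regularLevel_pushforward :
    ∀ (X₁ : Type) [TopologicalSpace X₁] [T2Space X₁] [CompactSpace X₁]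
      [ChartedSpace (EuclideanHalfSpace 4) X₁] [IsManifold (𝓡∂ 4) ∞ X₁]
      (b : BoundaryData (𝓡∂ 4) X₁ (𝓡 3)) (D : b.OpenCollar) (C : TopologicalSpace.Opens X₁)
      (X : Type) [TopologicalSpace X] [T2Space X] [ChartedSpace (EuclideanHalfSpace 4) X]
      [IsManifold (𝓡∂ 4) ∞ X] (jA : C → X)
      (M : Type) [TopologicalSpace M] [T2Space M] [ChartedSpace (EuclideanSpace ℝ (Fin 4)) M]
      [IsManifold (𝓡 4) ∞ M] (jX : X → M),
      (∀ x, (𝓡∂ 4).IsInteriorPoint x → x ∈ C) →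
      Manifold.IsSmoothEmbedding (𝓡∂ 4) (𝓡∂ 4) ∞ jA → IsOpen (Set.range jA) →
      Manifold.IsSmoothEmbedding (𝓡∂ 4) (𝓡 4) ∞ jX →
      ∃ G : M → ℝ, IsRegularLevel (𝓡 4) G CollarShrink.shrinkConst ∧
        (∀ p, p ∉ Set.range jX → G p = 0) ∧
        ∀ p, CollarShrink.shrinkConst ≤ G p ↔
          ∃ a : C, jX (jA a) = p ∧ (a : X₁) ∈ Set.range (D.shrink Set.univ) := by
  intro X₁ _ _ _ _ _ b D C X _ _ _ _ jA M _ _ _ _ jX hC hjA hjAo hjX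
  refine ⟨pushB D C jA jX, isRegularLevel_pushB D hC hjA hjAo hjX,
    fun p hp => pushB_of_not_mem D hp, fun p => ?_⟩
  rw [le_pushB_iff D hjA hjAo hjX.isEmbedding.injective]
  simp only [le_collarHeightFn_iff_mem_range_shrink]

end PushB

end Summit.SmoothPoincare4.SmoothPoincare4.Theorems.AcyclicBisectionExists.ModpBraidOrbits

end
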